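import Mathlib
import HarnessLib
import Summits.AtomisticToContinuum.FouriersLaw.Theses.ProfileLadder
import Summits.AtomisticToContinuum.FouriersLaw.Theorems.PuiseuxTransferLedgerContactIdentity
import Summits.AtomisticToContinuum.FouriersLaw.Theorems.BoundaryKubo.Negative.Reflection

/-!
# Birth skeleton (BC3) for crux `ProfileLadder.KapitzaBound`
(item `stmt-AtomisticToContinuum-12676`, route `route-AtomisticToContinuum-ProfileLadder`, crux rank 3, CONTACT RUNG;
sub-problem `FouriersLaw`; registrar `planner-skel-stmt-AtomisticToContinuum-12676-0`, 2026-08-17)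

Crux (FIXED, concluded BY NAME below): for `pinnedChain ω₂ lam β γ` (all `> 0`), under weak-NESS uniqueness,
along any steady-state family `μ`, for every `T > 0` and every contact depth `b` there are `C = C_b` and `N₀`
such that for all `N ≥ N₀`, every current response `d = D_N` and every kinetic-temperature response profile
`θ : Fin N → ℝ` (all difference quotients converging along `𝓝[≠] 0`):
`|θ i − 1/2| ≤ C (|d|+1)/(N−1)` for `i ≤ b` and `|θ i + 1/2| ≤ C (|d|+1)/(N−1)` for `i ≥ N−1−b`.

## Line `birth` — MAXIMUM PRINCIPLE AT THE HOT CONTACT × BOUNDED THERMAL CONTACT RESISTANCE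

What is ALREADY LANDED is not re-stubbed but used by name in the seam:
* the exact bath energy balance `γ(1/2 − θ 0) = d/(N−1) = γ(θ (N−1) + 1/2)` (`contactIdentity_proof`,
  `PuiseuxTransferLedger.ContactIdentity`, stmt-AtomisticToContinuum-12112): the thermostatted site is pinned to
  the bath perturbation up to exactly `ι/γ`, `ι := d/(N−1)` the per-bond current response;
* the reflection covariance of weak steady states (`Theorems/BoundaryKubo/Negative/Reflection.lean`:
  `isSteadyState_map_reflect`, `pinnedChain_V_even`), which with uniqueness gives the antisymmetry
  `θ (N−1−i) = −θ i` of the response profile (`profile_reflect` below, sorry-free; argument as in the sibling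
  line `Cruxes/BoundedResponseConverges/Lines/comonotone_local_resistance.lean`).
Modulo these, the crux is a statement about the LEFT contact layer `{0, …, b}` only, and a two-sided bound
`|θ i − 1/2| ≤ C X` (`X := (|d|+1)/(N−1)`) there has two one-sided halves with DIFFERENT engines:

* `stub_layerMaximum` (NO OVERSHOOT — a maximum principle for the linearised NESS at the hot contact):
  inside the left contact layer the response never exceeds its value at the thermostatted site,
  `θ i ≤ θ 0 + C X` for `i ≤ b`.  A SIGN / comparison statement: it follows from comonotonicity of the
  layer (the profile decreases away from the hot bath; no Rieder–Lebowitz–Lieb inversion, no boundary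
  meniscus above the contact value), i.e. from positivity / sign-regularity structure, with no quantitative
  control of resistances.  Size L (open for `lam, β > 0`; true at the harmonic corner and in every φ⁴ / FPU-β
  numeric on file: AokiKusnezov2001, LepriLiviPoliti2003 §6).
* `stub_contactResistance` (BOUNDED KAPITZA RESISTANCE of the layer): the response DEFICIT of the layer
  below the bath perturbation is `O(ι + 1/(N−1))`, `1/2 − θ i ≤ C X` for `i ≤ b` — the thermal resistance
  from the bath to depth `i`, `R_i = (1/2 − θ i)/ι`, stays bounded as `N → ∞` (`= 1/γ +` the layer's own
  series resistance).  A QUANTITATIVE conductance statement (engines: local bond-resistance bounds as in the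
  sibling stub `layerBounded`, the landed `FeketeSeriesLaw.PositiveConductance`, conductance lower bounds
  `JunctionLocality.ConductanceLowerBound`).  Size L (the item's own risk: anomalous, `N`-growing contact
  resistance — LepriLiviPoliti2016 §1.3.5, AokiKusnezov2001, Dhar2008 §3).
* COMPOSITION `KapitzaBound_of h₁ h₂` (kernel-checked, sorry-free): `N₀ = max (max N₁ N₂) 2`,
  `C = 1/γ + max C₁ 0 + max C₂ 0`; upper half from `stub_layerMaximum` + the landed contact identity
  (`θ 0 − 1/2 = −ι/γ ≤ |d|/(γ(N−1))`), lower half from `stub_contactResistance`, `abs_le`; the right contact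
  layer by the reflection antisymmetry `θ i = −θ (N−1−i)` (`|θ i + 1/2| = |θ (N−1−i) − 1/2|`, `N−1−i ≤ b`).

Why the cut is not a costume: `stub_layerMaximum` alone allows an arbitrarily over-cooled layer (unbounded
contact resistance, `θ i ≪ 1/2`), `stub_contactResistance` alone allows an overshoot above the bath value;
the crux needs both and implies both (`θ i − θ 0 ≤ |θ i − 1/2| + ι/γ`), so neither stub is a stronger bet
than the crux, and neither is cheaply the crux or the summit (BC3 probes `stub → KapitzaBound`,
`stub → FouriersLaw` by `first | exact? | simpa | aesop` FAIL for both; planner folder `bc/`, quoted in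
`Lines/birth.md`).  Both stubs keep the crux's full parameter / uniqueness / steady-family / limit prefix
verbatim (no statement about arbitrary `θ`); `N₀` absorbs the degenerate lengths (`N = 1`: both baths on one
site, the contact identity fails; the crux is false there, cf. its docstring "N₀ ≥ 2b+3").
Disproof used: none on file (no `Cruxes/KapitzaBound/` workfile before this one, no
`Theorems/KapitzaBound/Negative/` lemma, 2026-08-17).
-/

noncomputable section

namespace Summit.AtomisticToContinuum.FouriersLaw.Cruxes.KapitzaBound

namespace Birth

open MeasureTheory Filter Topology Set
open Literature.MathematicalPhysics.KineticTheory.HeatConduction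
open Summit.AtomisticToContinuum.FouriersLaw.Theorems.BoundaryKubo.Negative.Reflection

/-! ## The two registered stubs -/

/-- **stub 1 — `stub_layerMaximum` (no overshoot: maximum principle at the hot contact).**  For
`pinnedChain ω₂ lam β γ` (all `> 0`), under weak-NESS uniqueness, along any steady-state family, for every
`T > 0` and every contact depth `b` there are `C` and `N₀` such that for all `N ≥ N₀`, every current response
`d` and every kinetic-temperature response profile `θ : Fin N → ℝ` (all difference quotients converging), and
all sites `i`, `j` with `j = 0` (the thermostatted site) and `i ≤ b`:
`θ i ≤ θ j + C · (|d|+1)/(N−1)` — inside the left contact layer the linear response of the kinetic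
temperature never exceeds its value at the hot contact by more than `O(current response per bond + 1/N)`. -/
theorem stub_layerMaximum :
    ∀ ω₂ lam β γ : ℝ, 0 < ω₂ → 0 < lam → 0 < β → 0 < γ → (∀ (N : ℕ) (T_L T_R : ℝ), 0 < T_L → 0 < T_R → ∀ μ ν : MeasureTheory.Measure (Literature.MathematicalPhysics.KineticTheory.HeatConduction.PhaseSpace N), (Literature.MathematicalPhysics.KineticTheory.HeatConduction.pinnedChain ω₂ lam β γ).IsSteadyState N T_L T_R μ → (Literature.MathematicalPhysics.KineticTheory.HeatConduction.pinnedChain ω₂ lam β γ).IsSteadyState N T_L T_R ν → μ = ν) → ∀ μ : (N : ℕ) → ℝ → ℝ → MeasureTheory.Measure (Literature.MathematicalPhysics.KineticTheory.HeatConduction.PhaseSpace N), (∀ (N : ℕ) (T_L T_R : ℝ), 0 < T_L → 0 < T_R → (Literature.MathematicalPhysics.KineticTheory.HeatConduction.pinnedChain ω₂ lam β γ).IsSteadyState N T_L T_R (μ N T_L T_R)) → ∀ T : ℝ, 0 < T → ∀ b : ℕ, ∃ (C : ℝ) (N₀ : ℕ), ∀ (N : ℕ) (d : ℝ) (θ :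 Fin N → ℝ), N₀ ≤ N → Filter.Tendsto (fun δ : ℝ => (Literature.MathematicalPhysics.KineticTheory.HeatConduction.pinnedChain ω₂ lam β γ).totalCurrent (μ N (T + δ / 2) (T - δ / 2)) / δ) (nhdsWithin 0 {(0 : ℝ)}ᶜ) (nhds d) → (∀ i : Fin N, Filter.Tendsto (fun δ : ℝ => ((∫ x, (x.2 i) ^ 2 ∂(μ N (T + δ / 2) (T - δ / 2))) - ∫ x, (x.2 i) ^ 2 ∂(μ N T T)) / δ) (nhdsWithin 0 {(0 : ℝ)}ᶜ) (nhds (θ i))) → ∀ i j : Fin N, j.val = 0 → i.val ≤ b → θ i ≤ θ j + C * ((|d| + 1) / ((N : ℝ) - 1)) := by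
  sorry

/-- **stub 2 — `stub_contactResistance` (bounded thermal contact (Kapitza) resistance of the layer).**
For `pinnedChain ω₂ lam β γ` (all `> 0`), under weak-NESS uniqueness, along any steady-state family, for every
`T > 0` and every contact depth `b` there are `C` and `N₀` such that for all `N ≥ N₀`, every current response
`d` and every kinetic-temperature response profile `θ : Fin N → ℝ` (all difference quotients converging), and
every site `i ≤ b`: `1/2 − θ i ≤ C · (|d|+1)/(N−1)` — the response deficit of the left contact layer below the
bath perturbation `+1/2` is `O(current response per bond + 1/N)`: the thermal resistance from the hot bath to
depth `i`, `(1/2 − θ i)/(d/(N−1))`, stays bounded as `N → ∞`. -/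
theorem stub_contactResistance :
    ∀ ω₂ lam β γ : ℝ, 0 < ω₂ → 0 < lam → 0 < β → 0 < γ → (∀ (N : ℕ) (T_L T_R : ℝ), 0 < T_L → 0 < T_R → ∀ μ ν : MeasureTheory.Measure (Literature.MathematicalPhysics.KineticTheory.HeatConduction.PhaseSpace N), (Literature.MathematicalPhysics.KineticTheory.HeatConduction.pinnedChain ω₂ lam β γ).IsSteadyState N T_L T_R μ → (Literature.MathematicalPhysics.KineticTheory.HeatConduction.pinnedChain ω₂ lam β γ).IsSteadyState N T_L T_R ν → μ = ν) → ∀ μ : (N : ℕ) → ℝ → ℝ → MeasureTheory.Measure (Literature.MathematicalPhysics.KineticTheory.HeatConduction.PhaseSpace N), (∀ (N : ℕ) (T_L T_R : ℝ), 0 < T_L → 0 < T_R → (Literature.MathematicalPhysics.KineticTheory.HeatConduction.pinnedChain ω₂ lam β γ).IsSteadyState N T_L T_R (μ N T_L T_R)) → ∀ T : ℝ, 0 < T → ∀ b : ℕ, ∃ (C : ℝ) (N₀ : ℕ), ∀ (N : ℕ) (d : ℝ) (θ : Fin N → ℝ), N₀ ≤ N → Filter.Tendsto (fun δ : ℝ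 => (Literature.MathematicalPhysics.KineticTheory.HeatConduction.pinnedChain ω₂ lam β γ).totalCurrent (μ N (T + δ / 2) (T - δ / 2)) / δ) (nhdsWithin 0 {(0 : ℝ)}ᶜ) (nhds d) → (∀ i : Fin N, Filter.Tendsto (fun δ : ℝ => ((∫ x, (x.2 i) ^ 2 ∂(μ N (T + δ / 2) (T - δ / 2))) - ∫ x, (x.2 i) ^ 2 ∂(μ N T T)) / δ) (nhdsWithin 0 {(0 : ℝ)}ᶜ) (nhds (θ i))) → ∀ i : Fin N, i.val ≤ b → 1 / 2 - θ i ≤ C * ((|d| + 1) / ((N : ℝ) - 1)) := by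
  sorry

/-! ## Proved glue: reflection antisymmetry of the response profile (sorry-free) -/

/-- **Reflection antisymmetry of the kinetic-temperature response profile.**  Under weak-NESS uniqueness,
along a steady family of `pinnedChain ω₂ lam β γ`, for `T > 0`: `θ (N−1−i) = −θ i`.  The site reflection
maps the steady state at `(T_L, T_R)` to the steady state at `(T_R, T_L)` (`isSteadyState_map_reflect`,
landed in `Theorems/BoundaryKubo/Negative/Reflection.lean`), so `⟨p²_{N−1−i}⟩_{T+δ/2,T−δ/2} =
⟨p_i²⟩_{T−δ/2,T+δ/2}` and the difference quotient at the reflected site is minus the quotient at `i`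
evaluated at `−δ`.  (Argument verbatim from `profile_reflect` of the sibling line
`Cruxes/BoundedResponseConverges/Lines/comonotone_local_resistance.lean`, restated on `Fin N`.) [folklore] -/
theorem profile_reflect {ω₂ lam β γ : ℝ}
    (hU : ∀ (N : ℕ) (T_L T_R : ℝ), 0 < T_L → 0 < T_R → ∀ μ' ν' : Measure (PhaseSpace N),
      (pinnedChain ω₂ lam β γ).IsSteadyState N T_L T_R μ' →
        (pinnedChain ω₂ lam β γ).IsSteadyState N T_L T_R ν' → μ' = ν')
    {μ : (M : ℕ) → ℝ → ℝ → Measure (PhaseSpace M)}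
    (hμ : ∀ (N : ℕ) (T_L T_R : ℝ), 0 < T_L → 0 < T_R →
      (pinnedChain ω₂ lam β γ).IsSteadyState N T_L T_R (μ N T_L T_R))
    {T : ℝ} (hT : 0 < T) {N : ℕ} {θ : Fin N → ℝ}
    (hθ : ∀ i : Fin N, Tendsto (fun δ : ℝ =>
      ((∫ x, (x.2 i) ^ 2 ∂(μ N (T + δ / 2) (T - δ / 2))) - ∫ x, (x.2 i) ^ 2 ∂(μ N T T)) / δ)
      (𝓝[≠] 0) (𝓝 (θ i)))
    (i : Fin N) : θ (Fin.rev i) = -θ i := by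
  -- second moments along the family
  set m : Fin N → ℝ → ℝ → ℝ := fun k a b => ∫ x, (x.2 k) ^ 2 ∂(μ N a b) with hm
  have hswap : ∀ (k : Fin N) (a b : ℝ), 0 < a → 0 < b → m k b a = m (Fin.rev k) a b := by
    intro k a b ha hb
    have h1 := isSteadyState_map_reflect _ (pinnedChain_V_even ω₂ lam β γ) (hμ N a b ha hb)
    have h2 : μ N b a = (μ N a b).map (reflectCLE N) :=
      hU N b a hb ha _ _ (hμ N b a hb ha) h1
    simp only [hm]
    rw [h2, measurableEmbedding_reflect.integral_map]
    simp only [reflectCLE_snd]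
  have hθ' : ∀ k : Fin N, Tendsto (fun δ : ℝ => (m k (T + δ / 2) (T - δ / 2) - m k T T) / δ)
      (𝓝[≠] 0) (𝓝 (θ k)) := fun k => hθ k
  -- negation on the punctured neighbourhood
  have hneg : Tendsto (fun δ : ℝ => -δ) (𝓝[≠] (0 : ℝ)) (𝓝[≠] (0 : ℝ)) := by
    rw [tendsto_nhdsWithin_iff]
    constructor
    · have h : Tendsto (fun δ : ℝ => -δ) (𝓝 (0 : ℝ)) (𝓝 (0 : ℝ)) := by
        simpa using (continuous_neg.tendsto (0 : ℝ))
      exact h.mono_left nhdsWithin_le_nhds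
    · filter_upwards [self_mem_nhdsWithin] with δ hδ
      simpa using hδ
  have h1 : Tendsto (fun δ : ℝ => (m i (T + -δ / 2) (T - -δ / 2) - m i T T) / -δ)
      (𝓝[≠] 0) (𝓝 (θ i)) := (hθ' i).comp hneg
  have h2 := h1.neg
  have h3 : (fun δ : ℝ => -((m i (T + -δ / 2) (T - -δ / 2) - m i T T) / -δ))
      =ᶠ[𝓝[≠] (0 : ℝ)]
      (fun δ : ℝ => (m (Fin.rev i) (T + δ / 2) (T - δ / 2) - m (Fin.rev i) T T) / δ) := by
    have hI : Set.Ioo (-(2 * T)) (2 * T) ∈ 𝓝[≠] (0 : ℝ) :=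
      nhdsWithin_le_nhds (Ioo_mem_nhds (by linarith) (by linarith))
    filter_upwards [hI] with δ hδ
    have ha : 0 < T - δ / 2 := by linarith [hδ.2]
    have hb : 0 < T + δ / 2 := by linarith [hδ.1]
    have e1 : m (Fin.rev i) (T + δ / 2) (T - δ / 2) = m i (T - δ / 2) (T + δ / 2) := by
      rw [hswap (Fin.rev i) (T - δ / 2) (T + δ / 2) ha hb, Fin.rev_rev]
    have e2 : m (Fin.rev i) T T = m i T T := by
      rw [hswap (Fin.rev i) T T hT hT, Fin.rev_rev]
    rw [e1, e2, show T + -δ / 2 = T - δ / 2 by ring, show T - -δ / 2 = T + δ / 2 by ring,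
      div_neg, neg_neg]
  have h4 : Tendsto (fun δ : ℝ =>
      (m (Fin.rev i) (T + δ / 2) (T - δ / 2) - m (Fin.rev i) T T) / δ)
      (𝓝[≠] 0) (𝓝 (-θ i)) := h2.congr' h3
  exact tendsto_nhds_unique (hθ' (Fin.rev i)) h4

/-! ## The composition -/

/-- **Skeleton theorem — the crux `ProfileLadder.KapitzaBound` BY NAME from the two registered stub
statements** (sorry-free; the stubs enter only through `KapitzaBound_skeleton` below).  Seam: the landed
contact identity turns the maximum principle `θ i ≤ θ 0 + C₁X` into the upper half `θ i − 1/2 ≤ (1/γ + C₁)X`,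
the contact-resistance stub is the lower half, `abs_le`; the right contact layer is the reflection of the left
one (`profile_reflect`).  Constants: `C = 1/γ + max C₁ 0 + max C₂ 0`, `N₀ = max (max N₁ N₂) 2`. -/
theorem KapitzaBound_of
    (h1 : ∀ ω₂ lam β γ : ℝ, 0 < ω₂ → 0 < lam → 0 < β → 0 < γ → (∀ (N : ℕ) (T_L T_R : ℝ), 0 < T_L → 0 < T_R → ∀ μ ν : MeasureTheory.Measure (Literature.MathematicalPhysics.KineticTheory.HeatConduction.PhaseSpace N), (Literature.MathematicalPhysics.KineticTheory.HeatConduction.pinnedChain ω₂ lam β γ).IsSteadyState N T_L T_R μ → (Literature.MathematicalPhysics.KineticTheory.HeatConduction.pinnedChain ω₂ lam β γ).IsSteadyState N T_L T_R ν → μ = ν) → ∀ μ : (N : ℕ) → ℝ → ℝ → MeasureTheory.Measure (Literature.MathematicalPhysics.KineticTheory.HeatConduction.PhaseSpace N), (∀ (N : ℕ) (T_L T_R : ℝ), 0 < T_L → 0 < T_R → (Literature.MathematicalPhysics.KineticTheory.HeatConduction.pinnedChain ω₂ lam β γ).IsSteadyState N T_L T_R (μ N T_L T_R)) → ∀ T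 : ℝ, 0 < T → ∀ b : ℕ, ∃ (C : ℝ) (N₀ : ℕ), ∀ (N : ℕ) (d : ℝ) (θ : Fin N → ℝ), N₀ ≤ N → Filter.Tendsto (fun δ : ℝ => (Literature.MathematicalPhysics.KineticTheory.HeatConduction.pinnedChain ω₂ lam β γ).totalCurrent (μ N (T + δ / 2) (T - δ / 2)) / δ) (nhdsWithin 0 {(0 : ℝ)}ᶜ) (nhds d) → (∀ i : Fin N, Filter.Tendsto (fun δ : ℝ => ((∫ x, (x.2 i) ^ 2 ∂(μ N (T + δ / 2) (T - δ / 2))) - ∫ x, (x.2 i) ^ 2 ∂(μ N T T)) / δ) (nhdsWithin 0 {(0 : ℝ)}ᶜ) (nhds (θ i))) → ∀ i j : Fin N, j.val = 0 → i.val ≤ b → θ i ≤ θ j + C * ((|d| + 1) / ((N : ℝ) - 1)))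
    (h2 : ∀ ω₂ lam β γ : ℝ, 0 < ω₂ → 0 < lam → 0 < β → 0 < γ → (∀ (N : ℕ) (T_L T_R : ℝ), 0 < T_L → 0 < T_R → ∀ μ ν : MeasureTheory.Measure (Literature.MathematicalPhysics.KineticTheory.HeatConduction.PhaseSpace N), (Literature.MathematicalPhysics.KineticTheory.HeatConduction.pinnedChain ω₂ lam β γ).IsSteadyState N T_L T_R μ → (Literature.MathematicalPhysics.KineticTheory.HeatConduction.pinnedChain ω₂ lam β γ).IsSteadyState N T_L T_R ν → μ = ν) → ∀ μ : (N : ℕ) → ℝ → ℝ → MeasureTheory.Measure (Literature.MathematicalPhysics.KineticTheory.HeatConduction.PhaseSpace N), (∀ (N : ℕ) (T_L T_R : ℝ), 0 < T_L → 0 < T_R → (Literature.MathematicalPhysics.KineticTheory.HeatConduction.pinnedChain ω₂ lam β γ).IsSteadyState N T_L T_R (μ N T_L T_R)) → ∀ T : ℝ, 0 < T → ∀ b : ℕ, ∃ (C : ℝ) (N₀ : ℕ), ∀ (N : ℕ) (d : ℝ) (θ : Fin N → ℝ), N₀ ≤ N → Filter.Tendsto (fun δ : ℝ => (Literature.MathematicalPhysics.KineticTheory.HeatConduction.pinnedChain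 ω₂ lam β γ).totalCurrent (μ N (T + δ / 2) (T - δ / 2)) / δ) (nhdsWithin 0 {(0 : ℝ)}ᶜ) (nhds d) → (∀ i : Fin N, Filter.Tendsto (fun δ : ℝ => ((∫ x, (x.2 i) ^ 2 ∂(μ N (T + δ / 2) (T - δ / 2))) - ∫ x, (x.2 i) ^ 2 ∂(μ N T T)) / δ) (nhdsWithin 0 {(0 : ℝ)}ᶜ) (nhds (θ i))) → ∀ i : Fin N, i.val ≤ b → 1 / 2 - θ i ≤ C * ((|d| + 1) / ((N : ℝ) - 1))) :
    _root_.Summit.AtomisticToContinuum.FouriersLaw.Theses.ProfileLadder.KapitzaBound := by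
  intro ω₂ lam β γ hω hl hβ hγ hU μ hμ T hT b
  obtain ⟨C₁, N₁, hM⟩ := h1 ω₂ lam β γ hω hl hβ hγ hU μ hμ T hT b
  obtain ⟨C₂, N₂, hR⟩ := h2 ω₂ lam β γ hω hl hβ hγ hU μ hμ T hT b
  refine ⟨1 / γ + max C₁ 0 + max C₂ 0, max (max N₁ N₂) 2, ?_⟩
  intro N d θ hN hd hθ
  have hN₁ : N₁ ≤ N := le_trans (le_trans (le_max_left _ _) (le_max_left _ _)) hN
  have hN₂ : N₂ ≤ N := le_trans (le_trans (le_max_right _ _) (le_max_left _ _)) hN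
  have hN2 : 2 ≤ N := le_trans (le_max_right _ _) hN
  have h0N : 0 < N := by omega
  have hN1N : N - 1 < N := by omega
  have hNpos : (0 : ℝ) < (N : ℝ) - 1 := by
    have : (2 : ℝ) ≤ (N : ℝ) := by exact_mod_cast hN2
    linarith
  have hX0 : 0 ≤ (|d| + 1) / ((N : ℝ) - 1) := div_nonneg (by positivity) hNpos.le
  -- the exact contact identity at the thermostatted site `0` (landed `contactIdentity_proof`, stmt-12112)
  have hCI : γ * (1 / 2 - θ ⟨0, h0N⟩) = d / ((N : ℝ) - 1) :=
    (Summit.AtomisticToContinuum.FouriersLaw.Theorems.contactIdentity_proof ω₂ lam β γ hω hl hβ hγ hU μ hμ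
      T hT N d (θ ⟨0, h0N⟩) (θ ⟨N - 1, hN1N⟩) ⟨0, h0N⟩ ⟨N - 1, hN1N⟩ hN2 rfl rfl hd (hθ ⟨0, h0N⟩)
      (hθ ⟨N - 1, hN1N⟩)).1
  -- hence the contact value sits at most `|d|/(γ(N−1))` above the bath perturbation `1/2`
  have hanchor : θ ⟨0, h0N⟩ - 1 / 2 ≤ (1 / γ) * ((|d| + 1) / ((N : ℝ) - 1)) := by
    have e0 : 1 / 2 - θ ⟨0, h0N⟩ = d / ((N : ℝ) - 1) / γ := by
      rw [eq_div_iff hγ.ne', mul_comm]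
      exact hCI
    have e1 : θ ⟨0, h0N⟩ - 1 / 2 = (1 / γ) * (-d / ((N : ℝ) - 1)) := by
      calc θ ⟨0, h0N⟩ - 1 / 2 = -(1 / 2 - θ ⟨0, h0N⟩) := by ring
        _ = -(d / ((N : ℝ) - 1) / γ) := by rw [e0]
        _ = (1 / γ) * (-d / ((N : ℝ) - 1)) := by ring
    rw [e1]
    refine mul_le_mul_of_nonneg_left ?_ (by positivity)
    exact div_le_div_of_nonneg_right (by linarith [neg_le_abs d]) hNpos.le
  -- LEFT contact layer: maximum principle (upper half) + contact resistance (lower half)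
  have hleft : ∀ i : Fin N, i.val ≤ b →
      |θ i - 1 / 2| ≤ (1 / γ + max C₁ 0 + max C₂ 0) * ((|d| + 1) / ((N : ℝ) - 1)) := by
    intro i hi
    have hup := hM N d θ hN₁ hd hθ i ⟨0, h0N⟩ rfl hi
    have hlow := hR N d θ hN₂ hd hθ i hi
    have hC₁ : C₁ * ((|d| + 1) / ((N : ℝ) - 1)) ≤ max C₁ 0 * ((|d| + 1) / ((N : ℝ) - 1)) :=
      mul_le_mul_of_nonneg_right (le_max_left _ _) hX0
    have hC₂ : C₂ * ((|d| + 1) / ((N : ℝ) - 1)) ≤ max C₂ 0 * ((|d| + 1) / ((N : ℝ) - 1)) :=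
      mul_le_mul_of_nonneg_right (le_max_left _ _) hX0
    have hm₁ : 0 ≤ max C₁ 0 * ((|d| + 1) / ((N : ℝ) - 1)) := mul_nonneg (le_max_right _ _) hX0
    have hm₂ : 0 ≤ max C₂ 0 * ((|d| + 1) / ((N : ℝ) - 1)) := mul_nonneg (le_max_right _ _) hX0
    have hγX : 0 ≤ (1 / γ) * ((|d| + 1) / ((N : ℝ) - 1)) := mul_nonneg (by positivity) hX0
    have hdist : (1 / γ + max C₁ 0 + max C₂ 0) * ((|d| + 1) / ((N : ℝ) - 1)) =
        (1 / γ) * ((|d| + 1) / ((N : ℝ) - 1)) + max C₁ 0 * ((|d| + 1) / ((N : ℝ) - 1)) +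
          max C₂ 0 * ((|d| + 1) / ((N : ℝ) - 1)) := by ring
    rw [abs_le, hdist]
    constructor
    · linarith
    · linarith
  refine fun i => ⟨hleft i, fun hi => ?_⟩
  -- RIGHT contact layer: reflection antisymmetry `θ i = -θ (N-1-i)` and the left bound at `N-1-i ≤ b`
  have hrefl := profile_reflect hU hμ hT hθ (Fin.rev i)
  rw [Fin.rev_rev] at hrefl
  have hilt := i.isLt
  have hri : (Fin.rev i).val ≤ b := by
    rw [Fin.val_rev]
    omega
  have hl := hleft (Fin.rev i) hri
  rw [hrefl, show -θ (Fin.rev i) + 1 / 2 = -(θ (Fin.rev i) - 1 / 2) by ring, abs_neg]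
  exact hl

/-- The crux by name from the two registered (sorried) stubs: the only place the stubs are consumed. -/
theorem KapitzaBound_skeleton :
    _root_.Summit.AtomisticToContinuum.FouriersLaw.Theses.ProfileLadder.KapitzaBound :=
  KapitzaBound_of stub_layerMaximum stub_contactResistance

end Birth

end Summit.AtomisticToContinuum.FouriersLaw.Cruxes.KapitzaBound

end
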